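import Summits.NavierStokesRegularity.NavierStokesRegularity.Theses.LevelSetModeration

/-!
# Crux `HighSpeedPressureWork` (stmt-NavierStokesRegularity-18149, route `LevelSetModeration`),
# negative side I: the exponent `m < 10/3` is not load-bearing modulo an a priori speed bound

Negative-side (cdisprove, D-0016) structure theorems extracted from the crux work file
`Cruxes/HighSpeedPressureWork/Disproof.lean` §§0–1 (cycle 1), importable by ideators / planners /
provers. The crux: for `ν, T > 0` there are `m < 10/3` and `F` such that every classical
Leray–Hopf solution on `ℝ³ × [0, T)` from a rapidly decaying datum with `∫|u₀|² ≤ E₀`, `|u₀| ≤ B₀`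
has, for `M ≥ 2B₀`, `c ∈ [M/2, M]`, `t < T`, pressure work
`PW_c(t) = -∫₀ᵗ∫(1 - c/|u|)₊ u·∇p̃ ≤ √(F(E₀,B₀) M^m V_c(T)) √(D_c(T))` (`V` = space–time measure
of `{|u| > c}`, `D` = level-set dissipation of the speed).

* §0 `pressureWork`, `highSetMeasure`, `speedDissipation`, the fibre `HSPWWith ν T m F` and
  `highSpeedPressureWork_iff` (definitional), `pressureWork_eq_zero_of_speed_lt` (above the speed
  the work vanishes; the stagnation-point junk weight `1` is killed by `fderiv … x 0 = 0`).
* §1 `hspwWith_exponent_collapse` / `not_hspwWith_any_exponent_of_not`: modulo a uniform a priori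
  speed bound `APrioriSpeedBound ν T G` of the data class (Tao 2013-type quantitative regularity),
  the crux with ANY exponent `m₀ ≥ 0` (the "generic" `m = 4` included) implies the crux with
  exponent `0`: above `2G⁺ + 1` the super-level sets are empty and both sides vanish, below it
  `M^{m₀}` is absorbed by the modulus. So the constraint `m < 10/3` carries no difficulty of its
  own at fixed data bounds — it only measures growth in the amplification `M/B₀`, i.e. the crux is
  uniform quantitative regularity in disguise; a counterexample on a class with a priori bounds
  kills every exponent at once.
Nothing here closes the item (`--supports`). The scaling laws and the tightness of the data
modulus are in the sibling `ScalingTightness.lean`. [cite: Tao2011, §1 (qualitative vs quantitative regularity conjectures)]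
-/

noncomputable section

open MeasureTheory TopologicalSpace Set Function Filter Metric
open scoped Topology RealInnerProductSpace ContDiff InnerProductSpace ENNReal
open Literature.Analysis.FluidPDE
open Summit.NavierStokesRegularity.NavierStokesRegularity.Theses.LevelSetModeration

namespace Summit.NavierStokesRegularity.NavierStokesRegularity.Theorems.HighSpeedPressureWork.Negative

/-- Local notation for physical space `ℝ³ = EuclideanSpace ℝ (Fin 3)`. -/
local notation "ℝ³" => EuclideanSpace ℝ (Fin 3)

/-! ## §0 Vocabulary -/

/-- The LHS of the crux: the (minus) pressure work on the super-level set `{|u| > c}` up to time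
`t`, `PW_c(t) = -∫₀ᵗ∫ (1 - c/|u|)₊ u·∇p̃`. -/
def pressureWork (u : ℝ → ℝ³ → ℝ³) (c t : ℝ) : ℝ :=
  -(∫ τ in Set.Ioo 0 t, ∫ x, max (1 - c / ‖u τ x‖) 0 *
      (fderiv ℝ (normalisedPressure (u τ)) x (u τ x)))

/-- The space–time measure of the high-speed set, `V_c(T) = ∫₀ᵀ |{|u(τ)| > c}| dτ` (real part). -/
def highSetMeasure (u : ℝ → ℝ³ → ℝ³) (c T : ℝ) : ℝ :=
  (∫⁻ τ in Set.Ioo 0 T, volume {x | c < ‖u τ x‖}).toReal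

/-- The level-set dissipation of the speed, `D_c(T) = ∫₀ᵀ∫ 1_{|u|>c} |∇|u||²` (real part). -/
def speedDissipation (u : ℝ → ℝ³ → ℝ³) (c T : ℝ) : ℝ :=
  (∫⁻ τ in Set.Ioo 0 T, ∫⁻ x, Set.indicator {x | c < ‖u τ x‖}
      (fun x => ENNReal.ofReal (‖fderiv ℝ (fun y => ‖u τ y‖) x‖ ^ 2)) x).toReal

/-- The crux on the fibre `(ν, T)` with a FIXED exponent `m` and modulus `F`. -/
def HSPWWith (ν T m : ℝ) (F : ℝ → ℝ → ℝ) : Prop :=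
  ∀ (u : ℝ → ℝ³ → ℝ³) (p : ℝ → ℝ³ → ℝ),
    IsClassicalNSSolutionOn (Set.Ico 0 T) ν 0 u p → IsLerayHopfOn T ν 0 (u 0) u →
    HasRapidSpatialDecay (u 0) →
    ∀ (E₀ B₀ : ℝ), (∫ x, ‖u 0 x‖ ^ 2) ≤ E₀ → (∀ x, ‖u 0 x‖ ≤ B₀) →
    ∀ (M c t : ℝ), 2 * B₀ ≤ M → M / 2 ≤ c → c ≤ M → 0 < c → t ∈ Set.Ico 0 T →
    pressureWork u c t ≤
      Real.sqrt (F E₀ B₀ * M ^ m * highSetMeasure u c T) * Real.sqrt (speedDissipation u c T)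

/-- The crux, fibrewise (definitional unfolding). -/
theorem highSpeedPressureWork_iff :
    HighSpeedPressureWork ↔
      ∀ (ν T : ℝ), 0 < ν → 0 < T → ∃ m : ℝ, m < 10 / 3 ∧ ∃ F : ℝ → ℝ → ℝ, HSPWWith ν T m F :=
  Iff.rfl

/-- If the speed stays strictly below the level `c` on `(0, t) × ℝ³`, the pressure work on
`{|u| > c}` vanishes (the weight `(1 - c/|u|)₊` is zero; at stagnation points the junk weight
`1` is killed by `fderiv … x 0 = 0`). -/
theorem pressureWork_eq_zero_of_speed_lt {u : ℝ → ℝ³ → ℝ³} {c t : ℝ}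
    (h : ∀ τ ∈ Set.Ioo 0 t, ∀ x, ‖u τ x‖ < c) : pressureWork u c t = 0 := by
  have hinner : ∀ τ ∈ Set.Ioo 0 t,
      (∫ x, max (1 - c / ‖u τ x‖) 0 * (fderiv ℝ (normalisedPressure (u τ)) x (u τ x))) = 0 := by
    intro τ hτ
    have hfun : (fun x => max (1 - c / ‖u τ x‖) 0 *
        (fderiv ℝ (normalisedPressure (u τ)) x (u τ x))) = fun _ => 0 := by
      funext x
      by_cases hu : u τ x = 0
      · rw [hu, map_zero, mul_zero]
      · have hpos : 0 < ‖u τ x‖ := norm_pos_iff.2 hu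
        have hlt : 1 < c / ‖u τ x‖ := (one_lt_div hpos).2 (h τ hτ x)
        rw [max_eq_right (by linarith), zero_mul]
    rw [hfun, integral_zero]
  unfold pressureWork
  rw [setIntegral_congr_fun measurableSet_Ioo hinner, integral_zero, neg_zero]

/-- Both RHS factors are nonnegative. -/
theorem rhs_nonneg (a b : ℝ) : 0 ≤ Real.sqrt a * Real.sqrt b :=
  mul_nonneg (Real.sqrt_nonneg _) (Real.sqrt_nonneg _)

/-- `V ≥ 0` (real part of a lower Lebesgue integral). -/
theorem highSetMeasure_nonneg (u : ℝ → ℝ³ → ℝ³) (c T : ℝ) : 0 ≤ highSetMeasure u c T :=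
  ENNReal.toReal_nonneg

/-- `D ≥ 0` (real part of a lower Lebesgue integral). -/
theorem speedDissipation_nonneg (u : ℝ → ℝ³ → ℝ³) (c T : ℝ) : 0 ≤ speedDissipation u c T :=
  ENNReal.toReal_nonneg

/-! ## §1 The exponent is not load-bearing modulo an a priori speed bound -/

/-- A uniform a priori bound on the speed of the data class `(ν, T, E₀, B₀)`:
`‖u(t, x)‖ ≤ G(E₀, B₀)` on `[0, T) × ℝ³` for every classical Leray–Hopf solution from a rapidly
decaying datum with `∫|u₀|² ≤ E₀`, `|u₀| ≤ B₀` — uniform quantitative regularity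
(Tao 2011/2013, Localisation and compactness, §1: qualitative ⇔ quantitative conjectures). -/
def APrioriSpeedBound (ν T : ℝ) (G : ℝ → ℝ → ℝ) : Prop :=
  ∀ (u : ℝ → ℝ³ → ℝ³) (p : ℝ → ℝ³ → ℝ),
    IsClassicalNSSolutionOn (Set.Ico 0 T) ν 0 u p → IsLerayHopfOn T ν 0 (u 0) u →
    HasRapidSpatialDecay (u 0) →
    ∀ (E₀ B₀ : ℝ), (∫ x, ‖u 0 x‖ ^ 2) ≤ E₀ → (∀ x, ‖u 0 x‖ ≤ B₀) →
    ∀ t ∈ Set.Ico 0 T, ∀ x, ‖u t x‖ ≤ G E₀ B₀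

/-- **Exponent collapse.** Under an a priori speed bound `G`, the crux with ANY exponent
`m₀ ≥ 0` and modulus `F` implies the crux with exponent `0` and modulus
`F⁺ · (2 G⁺ + 1)^{m₀}`: above `M* = 2G⁺ + 1` the level sets are empty, below it `M^{m₀} ≤ M*^{m₀}`. -/
theorem hspwWith_exponent_collapse {ν T m₀ : ℝ} (hm₀ : 0 ≤ m₀) {F G : ℝ → ℝ → ℝ}
    (hG : APrioriSpeedBound ν T G) (h : HSPWWith ν T m₀ F) :
    HSPWWith ν T 0 (fun E₀ B₀ => max (F E₀ B₀) 0 * (2 * max (G E₀ B₀) 0 + 1) ^ m₀) := by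
  intro u p hcl hLH hdec E₀ B₀ hE hB M c t hM hMc hcM hc ht
  set Ms : ℝ := 2 * max (G E₀ B₀) 0 + 1 with hMs
  have hMs1 : 0 < Ms := by rw [hMs]; positivity
  rcases le_or_gt M Ms with hle | hgt
  · -- nontrivial range: absorb `M ^ m₀ ≤ Ms ^ m₀`
    have hM0 : 0 ≤ M := le_trans hc.le hcM
    have key := h u p hcl hLH hdec E₀ B₀ hE hB M c t hM hMc hcM hc ht
    refine key.trans (mul_le_mul_of_nonneg_right (Real.sqrt_le_sqrt ?_) (Real.sqrt_nonneg _))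
    rw [Real.rpow_zero, mul_one]
    have hV := highSetMeasure_nonneg u c T
    have h1 : F E₀ B₀ * M ^ m₀ ≤ max (F E₀ B₀) 0 * Ms ^ m₀ :=
      calc F E₀ B₀ * M ^ m₀ ≤ max (F E₀ B₀) 0 * M ^ m₀ :=
            mul_le_mul_of_nonneg_right (le_max_left _ _) (Real.rpow_nonneg hM0 _)
        _ ≤ max (F E₀ B₀) 0 * Ms ^ m₀ :=
            mul_le_mul_of_nonneg_left (Real.rpow_le_rpow hM0 hle hm₀) (le_max_right _ _)
    exact mul_le_mul_of_nonneg_right h1 hV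
  · -- above `Ms`: the level sets are empty on `[0, T)`, the pressure work vanishes
    have hspeed : ∀ τ ∈ Set.Ioo 0 t, ∀ x, ‖u τ x‖ < c := by
      intro τ hτ x
      have hτ' : τ ∈ Set.Ico 0 T := ⟨hτ.1.le, hτ.2.trans ht.2⟩
      have h1 := hG u p hcl hLH hdec E₀ B₀ hE hB τ hτ' x
      have h2 : G E₀ B₀ ≤ max (G E₀ B₀) 0 := le_max_left _ _
      linarith
    rw [pressureWork_eq_zero_of_speed_lt hspeed]
    exact rhs_nonneg _ _

/-- Negative reading of the exponent collapse (the positive class-level form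
`highSpeedPressureWork_of_aprioriSpeedBound` stays in the crux work file): a counterexample to the
crux on data classes carrying a priori speed bounds kills EVERY exponent `m₀ ≥ 0`, the "generic"
`m = 4` included — there is no intermediate, weaker-but-true exponent to retreat to. -/
theorem not_hspwWith_any_exponent_of_not {m₀ : ℝ} (hm₀ : 0 ≤ m₀)
    (hG : ∀ ν T : ℝ, 0 < ν → 0 < T → ∃ G, APrioriSpeedBound ν T G)
    (hneg : ¬ HighSpeedPressureWork) :
    ¬ ∀ ν T : ℝ, 0 < ν → 0 < T → ∃ F, HSPWWith ν T m₀ F := by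
  intro h
  refine hneg (highSpeedPressureWork_iff.2 fun ν T hν hT => ?_)
  obtain ⟨G, hG'⟩ := hG ν T hν hT
  obtain ⟨F, hF⟩ := h ν T hν hT
  exact ⟨0, by norm_num, _, hspwWith_exponent_collapse hm₀ hG' hF⟩


end Summit.NavierStokesRegularity.NavierStokesRegularity.Theorems.HighSpeedPressureWork.Negative

end
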